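import Mathlib
import Literature.Computability.Complexity.Classes
import Literature.Computability.Complexity.CircuitClasses
import Literature.Computability.Complexity.CircuitLightCone
import Literature.Computability.Complexity.ConstantDepth
import Literature.Computability.Complexity.StackLists
import Literature.Computability.Complexity.TimeBounds
import Literature.Computability.MetaComplexity.FormulaModelsAE
import Literature.Computability.MetaComplexity.BranchingPrograms
import Literature.Computability.MetaComplexity.ChenJinWilliams2020.ProbabilisticFormulas
import HarnessLib

/-!
# Chen–Jin–Williams 2020, §1.3 / §6: explicit obstructions against formulas and branching
# programs — Definition 1.12 (D10), Theorems 1.14–1.16, Proposition 1.17, Theorem 1.18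
# (census rows R58, R59)

Citation header. L. Chen, C. Jin, R. R. Williams, *Sharp threshold results for computational
complexity*, STOC 2020, 1335–1348, doi:10.1145/3357713.3384283 [bib: `ChenJinWilliams2020`].
Reproduced verbatim from the held text layer (`paper:doi-10-1145-3357713-3384283`, §1.3 = p. 7,
§6 = pp. 26 and 28; that layer prints `=` for `≠` and `⊂` for `⊄` — restored from sense and marked
`[≠]`, `[⊄]`):

* **Definition 1.12** (p. 7). *"An explicit 𝒞-obstruction (or explicit obstruction against 𝒞) is a
  (deterministic) polynomial-time algorithm A such that for all large enough n, A(1ⁿ) outputs a list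
  Lₙ = {(xᵢ, yᵢ)} such that xᵢ [≠] xⱼ for all i [≠] j, and for all n-input C ∈ 𝒞, there is an
  (xᵢ, yᵢ) ∈ Lₙ such that C(xᵢ) [≠] yᵢ."*
* **Theorem 1.14** (p. 7; p. 26: "against De Morgan formulas"). *"For a universal constant K > 0,
  there is an explicit obstruction against formulas of size n^{2−K/log log n}."*
* **Theorem 1.15** (p. 7 L13; "Reminder", p. 26). *"The following are equivalent: (1) There is an
  α > 0 and an explicit obstruction against formulas of size n^{2+α}. (2) For all k, there is an
  explicit obstruction against formulas of size nᵏ. (3) There is an ε > 0 and a function in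
  E = TIME[2^{O(n)}] that does not have 2^{εn}-size formulas, even infinitely often."* (Proof of
  (3) ⇒ (2), p. 26: *"In other words, for all but finitely many n, L ∩ {0,1}ⁿ has formula complexity
  greater than 2^{εn}."* — the reading of item (3) typed below.)
* **Theorem 1.16** (p. 7). *"If there is an unbounded function f(n) and an explicit obstruction
  against formulas of size n² · (log n)^{f(n)}, then E [⊄] NC¹."*
* **Proposition 1.17** ("Reminder", p. 28). *"There are explicit obstructions against B₂-formulas
  of size o(n), and branching programs of size o(n)."* Proof (p. 28): *"Note that an o(n)-size
  B₂-formula (or o(n)-size branching program) does not depend on all of its inputs. In such a case,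
  our obstruction can simply be the set S = {(0ⁿ, 0)} ∪ {(0^{i−1}10^{n−i}, 1) | i ∈ [n]}."*
  *"One interesting open problem is whether we can get explicit obstructions against cn-size
  B₂-formulas or branching programs, for every constant c ≥ 1."*
* **Theorem 1.18** (p. 7; "Reminder", p. 28). *"The following are equivalent: 1. There is an α > 0
  and an explicit obstruction against B₂-formulas of size n^{1+α}. 2. For all k, there is an
  explicit obstruction against B₂-formulas of size nᵏ. 3. There is an ε > 0 such that E cannot be
  computed by 2^{εn}-size formulas, even infinitely often. The same equivalence also holds with
  "branching programs" in place of "B₂-formulas.""*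
* §2.1: *"All logarithms are base-2. […] The size of a formula F, denoted by L(F), is the number of
  leaves in F."*

Not reproduced as a fact: Proposition 1.13 (p. 7: *"If there is an explicit obstruction against 𝒞,
then there is a function in P that is not in 𝒞."*; referee O29). Its NON-MEMBERSHIP half — an
obstruction at length `n` against `𝒞ₙ` exhibits an `n`-input function outside `𝒞ₙ`, the one it
tabulates — is the proved `exists_not_mem_of_refutesAll` below; its "in P" half (the tabulated
language is polynomial-time, by running the obstruction's printer and looking the input up) is NOT
typed here. Also not reproduced: the PRG clause announced in the prose before Theorem 1.15 and
Proposition 6.2 (no PRG vocabulary for formulas in the tree), Lemma 6.1 and all proofs except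
Proposition 1.17's.

## Rendering

* **D10 (`IsExplicitObstruction`).** The class `𝒞` is a length-indexed family of sets of Boolean
  FUNCTIONS `𝒞 n ⊆ ((Fin n → Bool) → Bool)` ("n-input C ∈ 𝒞" enters Definition 1.12 only through
  the values `C(xᵢ)`), so that De Morgan formulas, `B₂`-formulas (`Circuit.Computes`, leaf size
  `Circuit.leafSize`) and branching programs (`BranchingProgram.eval`, `size` = inner nodes) are
  all instances: `circuitFns P`, `deMorganFormulaFns s`, `b2FormulaFns s`, `bpFns s` (the same
  constraint lambdas as `FORMULAae` / `B2FORMULAae` / `BPSIZEae`). The algorithm is a function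
  `A : ℕ → List (List Bool × Bool)` (`A n` = the output on `1ⁿ`), polynomial-time in the sense of
  `PolyTimeComputable unaryEncodeNat obstructionEncode` (input `1ⁿ` in unary, as for `IsPRefuter`
  in `ConstructiveSeparations.lean`; output coded by `encList`, each pair `(x, y)` as the string
  `x ++ [y]`); "xᵢ ≠ xⱼ for i ≠ j" is `List.Nodup` of the first components; "C(xᵢ) ≠ yᵢ" is
  `Refutes`: some listed pair with `|xᵢ| = n` (implicit in print: an `n`-input `C` is applied to
  `xᵢ`) has `C(xᵢ) ≠ yᵢ`, the string read as the input vector `i ↦ xᵢ[i]`. Distinctness is what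
  keeps the notion honest: a list containing `(x, 0)` and `(x, 1)` refutes EVERY function
  (`refutesAll_of_inconsistent`), while a duplicate-free list never refutes the function it
  tabulates (`exists_not_refutes_of_nodup`) — so no class containing all functions has an
  obstruction, and an obstruction against `𝒞 n` exhibits a function outside `𝒞 n`
  (`exists_not_mem_of_refutesAll`, the non-membership half of Proposition 1.13, p. 7; the "in P"
  half of that proposition is not typed).
* Size bounds, leaves (§2.1). HYPOTHESIS side of the thresholds (an obstruction against a LARGER
  size bound is a stronger hypothesis; our class ⊇ the paper's ⇒ our hypothesis implies the
  paper's ⇒ the rendered implication is weaker-or-equal): `n^{2+α} ↦ ⌈N^{2+α}⌉₊`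
  (`thresholdBound13 α`, shared with Theorem 1.3), `n²(log n)^{f(n)} ↦ N²⌈log₂ N⌉^{f N}`
  (`thresholdBound14 f`, shared with Theorem 1.4; "unbounded f" ↦ `f → ∞`, a sub-family ⇒ weaker),
  `n^{1+α} ↦ ⌈N^{1+α}⌉₊`, `nᵏ ↦ Nᵏ`. KNOWN side (our class ⊆ the paper's ⇒ implied by print):
  `n^{2−K/log log n} ↦ ⌊N^{2−K/log₂log₂N}⌋₊` (`knownBound114 K`, real `K > 0`), `o(n)` ↦
  `s = o(n)` as `Asymptotics.IsLittleO` over `ℝ`. Item (3) of Theorems 1.15/1.18, which sits on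
  both sides of an equivalence, is typed with `⌊2^{εn}⌋₊` under `∃ ε > 0` (any rounding is absorbed
  by shrinking `ε`). In Theorem 1.18 item 3 *"formulas"* is read as `B₂`-formulas in the `B₂`
  version and as branching programs in the branching-program version — the reading under which the
  printed proof sketch (p. 28: *"the function F implemented in that proof has B₂-formula complexity
  at most n^{1+α/2}, and branching program complexity at most n^{1+α/2}"*, with Proposition 6.2
  *"formulas (respectively, branching programs)"*) is literal; flagged for the referee.
* Proposition 1.17 is SPLIT: its combinatorial content is PROVED (`refutes_unitObstruction_of_leafSize_lt`,
  `refutes_unitObstruction_bp_of_size_lt`: the printed list `S` refutes every circuit — any basis,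
  formula or not — with fewer than `n` leaves and every branching program with fewer than `n`
  nodes, because such a device does not read some variable: `card_lightCone_le_leafSize` +
  `Circuit.eval_congr_lightCone`, resp. `bp_eval_congr`), and `prop1_17_of_polyTime` derives the
  printed statement from the single residual hypothesis that `n ↦ S` is polynomial-time computable
  in the tree's TM2 model (`UnitObstructionPolyTime`, a programming exercise not carried out here);
  the printed proposition itself is ALSO recorded as the named fact `prop1_17`.

Typing layer (census rows R58/R59: `MagnificationGapCensus.lean`, `gap_R58*`, `gap_R59*`).
-/

namespace Literature.Computability.MetaComplexity.ChenJinWilliams2020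

open Finset Filter Asymptotics _root_.Computability Literature.Computability.Complexity
  Literature.Computability.MetaComplexity

variable {ι : Type*}

/-! ### Light cones are bounded by the leaf size (used for Proposition 1.17) -/

/-- The input variables wired directly into the gate `g` (its leaves). [folklore] -/
def gateLeaves [DecidableEq ι] (g : Gate ι) : Finset ι :=
  univ.biUnion fun a => Sum.elim (fun i => ({i} : Finset ι)) (fun _ => ∅) (g.args a)

/-- The input variables wired directly into some gate of the program `gs`. [folklore] -/
def leafUnion [DecidableEq ι] : List (Gate ι) → Finset ι
  | [] => ∅
  | g :: gs => gateLeaves g ∪ leafUnion gs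

/-- `leafUnion` is a monoid homomorphism from concatenation to union. [folklore] -/
theorem leafUnion_append [DecidableEq ι] (gs gs' : List (Gate ι)) :
    leafUnion (gs ++ gs') = leafUnion gs ∪ leafUnion gs' := by
  induction gs with
  | nil => simp [leafUnion]
  | cons g gs ih => simp [leafUnion, ih, Finset.union_assoc]

/-- Every dependency set (backward light cone of a gate) of a straight-line program consists of
leaves of the program. [folklore] -/
theorem deps_getD_subset_leafUnion [DecidableEq ι] (gs : List (Gate ι)) :
    ∀ m, (GateList.deps gs).getD m ∅ ⊆ leafUnion gs := by
  induction gs using List.reverseRecOn with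
  | nil => intro m; simp [GateList.deps]
  | append_singleton gs g ih =>
    intro m
    rw [GateList.deps_append_singleton, leafUnion_append]
    rcases lt_or_ge m gs.length with h | h
    · rw [List.getD_append _ _ _ _ (by simpa using h)]
      exact (ih m).trans subset_union_left
    · rw [List.getD_append_right _ _ _ _ (by simpa using h)]
      rcases Nat.eq_zero_or_pos (m - gs.length) with h0 | hpos
      · have h0d : m - (GateList.deps gs).length = 0 := by simpa using h0
        rw [h0d, List.getD_cons_zero]
        intro i hi
        simp only [GateList.depOf, mem_biUnion, mem_univ, true_and] at hi
        obtain ⟨a, ha⟩ := hi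
        cases hga : g.args a with
        | inl j =>
          rw [hga] at ha
          simp only [mem_singleton] at ha
          subst ha
          apply mem_union_right
          simp only [leafUnion, union_empty, gateLeaves, mem_biUnion, mem_univ, true_and]
          exact ⟨a, by rw [hga]; simp⟩
        | inr m' =>
          rw [hga] at ha
          exact mem_union_left _ (ih m' ha)
      · have : (GateList.deps gs).length = gs.length := by simp
        rw [this, List.getD_eq_default _ _ (by simp; omega)]
        exact empty_subset _

/-- Counting over `List.ofFn` is a sum over `Fin k`. [folklore] -/
theorem countP_ofFn_eq_sum {α : Type*} {k : ℕ} (f : Fin k → α) (p : α → Bool) :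
    (List.ofFn f).countP p = ∑ a : Fin k, if p (f a) then 1 else 0 := by
  induction k with
  | zero => simp
  | succ k ih =>
    rw [List.ofFn_succ, List.countP_cons, Fin.sum_univ_succ, ih]
    split
    · simp_all; omega
    · simp_all

/-- A gate has at most as many leaves as leaf slots. [folklore] -/
theorem card_gateLeaves_le [DecidableEq ι] (g : Gate ι) :
    (gateLeaves g).card ≤ (List.ofFn g.args).countP fun w => w.isLeft := by
  rw [countP_ofFn_eq_sum]
  refine card_biUnion_le.trans (sum_le_sum fun a _ => ?_)
  cases g.args a <;> simp

/-- A program has at most as many leaves as leaf slots. [folklore] -/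
theorem card_leafUnion_le [DecidableEq ι] (gs : List (Gate ι)) :
    (leafUnion gs).card ≤ (gs.map fun g => (List.ofFn g.args).countP fun w => w.isLeft).sum := by
  induction gs with
  | nil => simp [leafUnion]
  | cons g gs ih =>
    simp only [leafUnion, List.map_cons, List.sum_cons]
    exact (card_union_le _ _).trans (Nat.add_le_add (card_gateLeaves_le g) ih)

/-- **The light cone of a circuit has at most `leafSize` variables** (any basis, formula or not).
[folklore] -/
theorem card_lightCone_le_leafSize [DecidableEq ι] (C : Circuit ι) :
    C.lightCone.card ≤ C.leafSize := by
  unfold Circuit.lightCone Circuit.leafSize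
  cases ho : C.output with
  | inl i => simp
  | inr m =>
    simp only [Sum.isLeft_inr, Bool.false_eq_true, ↓reduceIte, add_zero]
    exact (card_le_card (deps_getD_subset_leafUnion C.gates m)).trans (card_leafUnion_le C.gates)

/-- A circuit on `n` variables with fewer than `n` leaves does not read some variable: *"an
o(n)-size B₂-formula […] does not depend on all of its inputs"* (p. 28). [cite: ChenJinWilliams2020, Prop. 1.17 (proof)] -/
theorem exists_not_mem_lightCone {n : ℕ} (C : Circuit (Fin n)) (h : C.leafSize < n) :
    ∃ i : Fin n, i ∉ C.lightCone := by
  by_contra hall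
  push Not at hall
  have hsub : (univ : Finset (Fin n)) ⊆ C.lightCone := fun i _ => hall i
  have := (card_le_card hsub).trans (card_lightCone_le_leafSize C)
  simp at this
  omega

/-! ### Branching programs: an unqueried variable is not read -/

/-- Two inputs agreeing on every queried variable drive a branching program along the same path.
[folklore] -/
theorem bp_evalFrom_congr {n : ℕ} (P : BranchingProgram n) {x x' : Fin n → Bool}
    (h : ∀ v, x (P.var v) = x' (P.var v)) :
    ∀ (fuel : ℕ) (s : Fin P.m ⊕ Bool), P.evalFrom x fuel s = P.evalFrom x' fuel s
  | _, Sum.inr b => by simp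
  | 0, Sum.inl v => by simp [BranchingProgram.evalFrom]
  | fuel + 1, Sum.inl v => by
    rw [BranchingProgram.evalFrom_succ_inl, BranchingProgram.evalFrom_succ_inl, h v]
    exact bp_evalFrom_congr P h fuel _

/-- Two inputs agreeing on every queried variable give a branching program the same value.
[folklore] -/
theorem bp_eval_congr {n : ℕ} (P : BranchingProgram n) {x x' : Fin n → Bool}
    (h : ∀ v, x (P.var v) = x' (P.var v)) : P.eval x = P.eval x' :=
  bp_evalFrom_congr P h _ _

/-- A branching program on `n` variables with fewer than `n` inner nodes leaves some variable
unqueried: *"an o(n)-size branching program does not depend on all of its inputs"* (p. 28).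
[cite: ChenJinWilliams2020, Prop. 1.17 (proof)] -/
theorem bp_exists_unqueried {n : ℕ} (P : BranchingProgram n) (h : P.size < n) :
    ∃ i : Fin n, ∀ v, P.var v ≠ i := by
  by_contra hall
  push Not at hall
  have hs : Function.Surjective P.var := fun i => hall i
  have := Fintype.card_le_of_surjective _ hs
  simp [BranchingProgram.size] at this h
  omega

/-! ### Definition 1.12 (D10): explicit obstructions -/

/-- The output coding of an obstruction list: each pair `(x, y)` as the string `x ++ [y]`, the list
of these strings as nested pairs (`encList`). [folklore] -/
def obstructionEncode (l : List (List Bool × Bool)) : List Bool :=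
  encList (l.map fun p => p.1 ++ [p.2])

/-- The list `l` REFUTES the `n`-input function `f`: some listed pair `(x, y)` with `|x| = n` has
`f(x) ≠ y` ("there is an (xᵢ, yᵢ) ∈ Lₙ such that C(xᵢ) ≠ yᵢ", Definition 1.12; the string `x` is
read as the input vector `i ↦ x[i]`). [cite: ChenJinWilliams2020, Def. 1.12] -/
def Refutes (l : List (List Bool × Bool)) (n : ℕ) (f : (Fin n → Bool) → Bool) : Prop :=
  ∃ p ∈ l, p.1.length = n ∧ f (fun i => p.1.getD i false) ≠ p.2

/-- The list `l` is an obstruction AT LENGTH `n` against the set of `n`-input functions `𝒞ₙ`: its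
inputs are pairwise distinct ("xᵢ ≠ xⱼ for all i ≠ j") and it refutes every member of `𝒞ₙ` — the
per-length clause of Definition 1.12. [cite: ChenJinWilliams2020, Def. 1.12] -/
def RefutesAll (l : List (List Bool × Bool)) (n : ℕ) (𝒞ₙ : Set ((Fin n → Bool) → Bool)) : Prop :=
  (l.map Prod.fst).Nodup ∧ ∀ f ∈ 𝒞ₙ, Refutes l n f

/-- **Explicit obstruction against `𝒞` (Definition 1.12, D10).** `A : ℕ → List (List Bool × Bool)`
(`A n` = the output of the algorithm on `1ⁿ`) is polynomial-time computable from the unary input,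
and for all large enough `n` the list `A n` has pairwise distinct inputs and refutes every `n`-input
function of the class `𝒞 n`. Printed: *"a (deterministic) polynomial-time algorithm A such that for
all large enough n, A(1ⁿ) outputs a list Lₙ = {(xᵢ, yᵢ)} such that xᵢ ≠ xⱼ for all i ≠ j, and for
all n-input C ∈ 𝒞, there is an (xᵢ, yᵢ) ∈ Lₙ such that C(xᵢ) ≠ yᵢ."*
[cite: ChenJinWilliams2020, Def. 1.12] -/
def IsExplicitObstruction (𝒞 : ∀ n : ℕ, Set ((Fin n → Bool) → Bool))
    (A : ℕ → List (List Bool × Bool)) : Prop :=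
  PolyTimeComputable unaryEncodeNat obstructionEncode A ∧ ∀ᶠ n in atTop, RefutesAll (A n) n (𝒞 n)

/-- *"There is an explicit obstruction against 𝒞."* [cite: ChenJinWilliams2020, Def. 1.12] -/
def HasExplicitObstruction (𝒞 : ∀ n : ℕ, Set ((Fin n → Bool) → Bool)) : Prop :=
  ∃ A, IsExplicitObstruction 𝒞 A

/-! ### The classes: functions computed by small formulas / branching programs -/

/-- The `n`-input Boolean functions computed by some `n`-input circuit satisfying the constraint
`P n` (the constraint lambdas of `FamilyAE`). [folklore] -/
def circuitFns (P : ∀ n : ℕ, Circuit (Fin n) → Prop) (n : ℕ) : Set ((Fin n → Bool) → Bool) :=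
  {f | ∃ C : Circuit (Fin n), P n C ∧ C.Computes f}

/-- *"formulas of size s"*: functions with a De Morgan formula (`{∧₂, ∨₂, ¬}`, fan-out `≤ 1`) of at
most `s n` leaves — the constraint of `FORMULAae s`. [cite: ChenJinWilliams2020, §2.1 (De Morgan formulas, size = leaves)] -/
def deMorganFormulaFns (s : ℕ → ℕ) : ∀ n : ℕ, Set ((Fin n → Bool) → Bool) :=
  circuitFns fun n C => C.IsOver deMorganBasis ∧ C.IsFormula ∧ C.leafSize ≤ s n

/-- *"B₂-formulas (formulas over AND, OR, and XOR) of size s"*: functions with a formula over the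
full binary basis of at most `s n` leaves — the constraint of `B2FORMULAae s`. [cite: ChenJinWilliams2020, §1.3 (B₂-formulas)] -/
def b2FormulaFns (s : ℕ → ℕ) : ∀ n : ℕ, Set ((Fin n → Bool) → Bool) :=
  circuitFns fun n C => C.IsOver B2 ∧ C.IsFormula ∧ C.leafSize ≤ s n

/-- *"branching programs of size s"*: functions computed by a deterministic branching program with
at most `s n` inner nodes — the size measure of `BPSIZEae s`. [cite: ChenJinWilliams2020, §1.3 (branching programs)] -/
def bpFns (s : ℕ → ℕ) (n : ℕ) : Set ((Fin n → Bool) → Bool) :=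
  {f | ∃ P : BranchingProgram n, P.size ≤ s n ∧ ∀ x, P.eval x = f x}

/-- The function a language cuts out on `{0,1}ⁿ`, as an `n`-input Boolean function.
[folklore] -/
noncomputable def sliceFn (L : Language Bool) (n : ℕ) : (Fin n → Bool) → Bool :=
  fun x => L.boolIndicator (List.ofFn x)

/-- *"a function in E that does not have [𝒞-devices], even infinitely often"* — *"in other words,
for all but finitely many n, L ∩ {0,1}ⁿ has [𝒞-]complexity greater than [the bound]"* (p. 26):
some `L ∈ E` whose length-`n` slice lies outside `𝒞 n` for all large `n`.
[cite: ChenJinWilliams2020, Thm. 1.15 (item 3, proof of (3) ⇒ (2))] -/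
def EHardAE (𝒞 : ∀ n : ℕ, Set ((Fin n → Bool) → Bool)) : Prop :=
  ∃ L ∈ E, ∀ᶠ n in atTop, sliceFn L n ∉ 𝒞 n

/-! ### Size bounds -/

/-- `2^{εn}`, rounded down. [cite: ChenJinWilliams2020, Thm. 1.15 (parameters)] -/
noncomputable def expBound (ε : ℝ) (n : ℕ) : ℕ := ⌊(2 : ℝ) ^ (ε * n)⌋₊

/-- The known bound `n^{2−K/log log n}` of Theorem 1.14, in leaves, rounded down (logarithms base 2,
§2.1). [cite: ChenJinWilliams2020, Thm. 1.14 (parameters)] -/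
noncomputable def knownBound114 (K : ℝ) (n : ℕ) : ℕ :=
  ⌊(n : ℝ) ^ (2 - K / Real.logb 2 (Real.logb 2 n))⌋₊

/-! ### Theorems 1.14–1.16 (De Morgan formulas; census row R58) -/

/-- **Theorem 1.14** (known, constructive): *"For a universal constant K > 0, there is an explicit
obstruction against formulas of size n^{2−K/log log n}."* (Its printed construction, p. 26, is *"S :=
{(x_{ρ,i}, PARITY(x_{ρ,i})) : ρ ∈ Q, i ∈ {0,1,…,n}}"*, which *"may contain repetitions"*; the
distinctness clause of Definition 1.12 then needs the evident duplicate-removal pass.)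
[cite: ChenJinWilliams2020, Thm. 1.14] -/
def thm1_14 : Prop := ∃ K : ℝ, 0 < K ∧ HasExplicitObstruction (deMorganFormulaFns (knownBound114 K))

/-- Theorem 1.15, item (1): *"There is an α > 0 and an explicit obstruction against formulas of size
n^{2+α}."* [cite: ChenJinWilliams2020, Thm. 1.15 (item 1)] -/
def Item115i : Prop := ∃ α : ℝ, 0 < α ∧ HasExplicitObstruction (deMorganFormulaFns (thresholdBound13 α))

/-- Theorem 1.15, item (2): *"For all k, there is an explicit obstruction against formulas of size
nᵏ."* [cite: ChenJinWilliams2020, Thm. 1.15 (item 2)] -/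
def Item115ii : Prop := ∀ k : ℕ, HasExplicitObstruction (deMorganFormulaFns fun n => n ^ k)

/-- Theorem 1.15, item (3): *"There is an ε > 0 and a function in E = TIME[2^{O(n)}] that does not
have 2^{εn}-size formulas, even infinitely often."* [cite: ChenJinWilliams2020, Thm. 1.15 (item 3)] -/
def Item115iii : Prop := ∃ ε : ℝ, 0 < ε ∧ EHardAE (deMorganFormulaFns (expBound ε))

/-- **Theorem 1.15** (sharp threshold for explicit obstructions against De Morgan formulas): items
(1), (2), (3) are equivalent. [cite: ChenJinWilliams2020, Thm. 1.15] -/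
def thm1_15 : Prop := (Item115i ↔ Item115ii) ∧ (Item115ii ↔ Item115iii)

/-- The hypothesis of Theorem 1.16 for the growth function `f`: an explicit obstruction against
formulas of `N²⌈log₂ N⌉^{f N}` leaves. [cite: ChenJinWilliams2020, Thm. 1.16 (hypothesis)] -/
def Hypothesis116 (f : ℕ → ℕ) : Prop := HasExplicitObstruction (deMorganFormulaFns (thresholdBound14 f))

/-- **Theorem 1.16** (threshold): *"If there is an unbounded function f(n) and an explicit
obstruction against formulas of size n² · (log n)^{f(n)}, then E ⊄ NC¹."* ("unbounded" rendered as
`f → ∞`, a sub-family.) [cite: ChenJinWilliams2020, Thm. 1.16] -/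
def thm1_16 : Prop := (∃ f : ℕ → ℕ, Tendsto f atTop atTop ∧ Hypothesis116 f) → ¬ (E ⊆ NC1)

/-! ### Proposition 1.17 and Theorem 1.18 (`B₂`-formulas, branching programs; census row R59) -/

/-- **Proposition 1.17** (known, constructive), as printed: *"There are explicit obstructions
against B₂-formulas of size o(n), and branching programs of size o(n)."* — for every `s = o(n)`.
See `prop1_17_of_polyTime` for the proof modulo the running time of the printed list.
[cite: ChenJinWilliams2020, Prop. 1.17] -/
def prop1_17 : Prop :=
  ∀ s : ℕ → ℕ, (fun n => (s n : ℝ)) =o[atTop] (fun n => (n : ℝ)) →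
    HasExplicitObstruction (b2FormulaFns s) ∧ HasExplicitObstruction (bpFns s)

/-- Theorem 1.18, item 1: *"There is an α > 0 and an explicit obstruction against B₂-formulas of size
n^{1+α}."* (`⌈N^{1+α}⌉₊` leaves.) [cite: ChenJinWilliams2020, Thm. 1.18 (item 1)] -/
def Item118i : Prop :=
  ∃ α : ℝ, 0 < α ∧ HasExplicitObstruction (b2FormulaFns fun n => ⌈(n : ℝ) ^ (1 + α)⌉₊)

/-- Theorem 1.18, item 2: *"For all k, there is an explicit obstruction against B₂-formulas of size
nᵏ."* [cite: ChenJinWilliams2020, Thm. 1.18 (item 2)] -/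
def Item118ii : Prop := ∀ k : ℕ, HasExplicitObstruction (b2FormulaFns fun n => n ^ k)

/-- Theorem 1.18, item 3 (`B₂` version): *"There is an ε > 0 such that E cannot be computed by
2^{εn}-size formulas, even infinitely often"* — "formulas" read as `B₂`-formulas (see the module
docstring). [cite: ChenJinWilliams2020, Thm. 1.18 (item 3)] -/
def Item118iii : Prop := ∃ ε : ℝ, 0 < ε ∧ EHardAE (b2FormulaFns (expBound ε))

/-- **Theorem 1.18** (`B₂`-formulas): items 1, 2, 3 are equivalent. [cite: ChenJinWilliams2020, Thm. 1.18] -/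
def thm1_18 : Prop := (Item118i ↔ Item118ii) ∧ (Item118ii ↔ Item118iii)

/-- Theorem 1.18, item 1, branching-program version. [cite: ChenJinWilliams2020, Thm. 1.18 (branching programs)] -/
def Item118bpi : Prop :=
  ∃ α : ℝ, 0 < α ∧ HasExplicitObstruction (bpFns fun n => ⌈(n : ℝ) ^ (1 + α)⌉₊)

/-- Theorem 1.18, item 2, branching-program version. [cite: ChenJinWilliams2020, Thm. 1.18 (branching programs)] -/
def Item118bpii : Prop := ∀ k : ℕ, HasExplicitObstruction (bpFns fun n => n ^ k)

/-- Theorem 1.18, item 3, branching-program version ("formulas" ↦ branching programs).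
[cite: ChenJinWilliams2020, Thm. 1.18 (branching programs)] -/
def Item118bpiii : Prop := ∃ ε : ℝ, 0 < ε ∧ EHardAE (bpFns (expBound ε))

/-- **Theorem 1.18**, branching-program version: *"The same equivalence also holds with "branching
programs" in place of "B₂-formulas.""* [cite: ChenJinWilliams2020, Thm. 1.18 (branching programs)] -/
def thm1_18bp : Prop := (Item118bpi ↔ Item118bpii) ∧ (Item118bpii ↔ Item118bpiii)

/-! ### Proved: the structure of Definition 1.12 -/

/-- A list containing both `(x, 0)` and `(x, 1)` (with `|x| = n`) refutes every `n`-input function —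
the reason Definition 1.12 demands distinct inputs. [folklore] -/
theorem refutes_of_inconsistent {l : List (List Bool × Bool)} {n : ℕ} {x : List Bool}
    (hx : x.length = n) (h0 : (x, false) ∈ l) (h1 : (x, true) ∈ l) (f : (Fin n → Bool) → Bool) :
    Refutes l n f := by
  cases hf : f (fun i => x.getD i false)
  · exact ⟨(x, true), h1, hx, by rw [show (x, true).1 = x from rfl, hf]; exact Bool.false_ne_true⟩
  · exact ⟨(x, false), h0, hx, by rw [show (x, false).1 = x from rfl, hf]; exact fun h => Bool.false_ne_true h.symm⟩

/-- The function tabulated by a list: `x ↦ y` if `(x, y)` is listed (first hit), else `false`.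
[folklore] -/
def tabulated (l : List (List Bool × Bool)) (n : ℕ) : (Fin n → Bool) → Bool :=
  fun x => ((l.find? fun p => p.1 == List.ofFn x).map Prod.snd).getD false

/-- Reading a length-`n` string as an input vector and listing it again gives the string back.
[folklore] -/
theorem ofFn_getD {n : ℕ} {x : List Bool} (hx : x.length = n) :
    List.ofFn (fun i : Fin n => x.getD i false) = x := by
  subst hx
  apply List.ext_getElem (by simp)
  intro i h₁ h₂
  simp [List.getD_eq_getElem?_getD]

/-- On a listed input of a duplicate-free list the tabulated function returns the listed output.
[folklore] -/
theorem tabulated_eq_of_mem {l : List (List Bool × Bool)} {n : ℕ} (hl : (l.map Prod.fst).Nodup)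
    {p : List Bool × Bool} (hp : p ∈ l) (hx : p.1.length = n) :
    tabulated l n (fun i => p.1.getD i false) = p.2 := by
  unfold tabulated
  rw [ofFn_getD hx]
  have hfind : l.find? (fun q => q.1 == p.1) = some p := by
    induction l with
    | nil => simp at hp
    | cons q l ih =>
      simp only [List.map_cons, List.nodup_cons, List.mem_map, not_exists, not_and] at hl
      rcases List.mem_cons.1 hp with rfl | hp'
      · simp
      · have hne : q.1 ≠ p.1 := fun h => hl.1 p hp' h.symm
        rw [List.find?_cons_of_neg (by simpa using hne)]
        exact ih hl.2 hp'
  simp [hfind]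

/-- **A duplicate-free list never refutes the function it tabulates**: so no class containing every
`n`-input function admits an obstruction at length `n`. [folklore] -/
theorem not_refutes_tabulated {l : List (List Bool × Bool)} {n : ℕ} (hl : (l.map Prod.fst).Nodup) :
    ¬ Refutes l n (tabulated l n) := by
  rintro ⟨p, hp, hx, hne⟩
  exact hne (tabulated_eq_of_mem hl hp hx)

/-- **Obstructions imply lower bounds** (the non-membership half of Proposition 1.13, p. 7 — the
printed statement moreover puts the function in `P`, via the obstruction's polynomial-time printer;
that half is not typed here): a list that is an obstruction at length `n` against `𝒞ₙ` exhibits an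
`n`-input function outside `𝒞ₙ`, namely the one it tabulates.
[cite: ChenJinWilliams2020, Prop. 1.13 (non-membership half)] -/
theorem exists_not_mem_of_refutesAll {l : List (List Bool × Bool)} {n : ℕ}
    {𝒞ₙ : Set ((Fin n → Bool) → Bool)} (h : RefutesAll l n 𝒞ₙ) :
    ∃ g : (Fin n → Bool) → Bool, g ∉ 𝒞ₙ :=
  ⟨tabulated l n, fun hg => not_refutes_tabulated h.1 (h.2 _ hg)⟩

/-- No list is an obstruction against the class of ALL `n`-input functions. [folklore] -/
theorem not_refutesAll_univ (l : List (List Bool × Bool)) (n : ℕ) : ¬ RefutesAll l n Set.univ :=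
  fun h => (exists_not_mem_of_refutesAll h).elim fun _ hg => hg trivial

/-- Refuting is antitone in the class. [folklore] -/
theorem RefutesAll.anti {l : List (List Bool × Bool)} {n : ℕ} {𝒞ₙ 𝒞ₙ' : Set ((Fin n → Bool) → Bool)}
    (h𝒞 : 𝒞ₙ' ⊆ 𝒞ₙ) (h : RefutesAll l n 𝒞ₙ) : RefutesAll l n 𝒞ₙ' :=
  ⟨h.1, fun f hf => h.2 f (h𝒞 hf)⟩

/-- **An explicit obstruction against a class is one against every eventually-smaller class.**
[cite: ChenJinWilliams2020, Def. 1.12] -/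
theorem IsExplicitObstruction.anti {𝒞 𝒞' : ∀ n : ℕ, Set ((Fin n → Bool) → Bool)}
    {A : ℕ → List (List Bool × Bool)} (h𝒞 : ∀ᶠ n in atTop, 𝒞' n ⊆ 𝒞 n)
    (h : IsExplicitObstruction 𝒞 A) : IsExplicitObstruction 𝒞' A :=
  ⟨h.1, (h.2.and h𝒞).mono fun _ hn => hn.1.anti hn.2⟩

/-- `HasExplicitObstruction` is antitone in the class (eventually). [cite: ChenJinWilliams2020, Def. 1.12] -/
theorem HasExplicitObstruction.anti {𝒞 𝒞' : ∀ n : ℕ, Set ((Fin n → Bool) → Bool)}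
    (h𝒞 : ∀ᶠ n in atTop, 𝒞' n ⊆ 𝒞 n) (h : HasExplicitObstruction 𝒞) : HasExplicitObstruction 𝒞' :=
  h.imp fun _ hA => hA.anti h𝒞

/-- `circuitFns` is monotone in the constraint. [folklore] -/
theorem circuitFns_mono {P P' : ∀ n : ℕ, Circuit (Fin n) → Prop} {n : ℕ} (h : ∀ C, P n C → P' n C) :
    circuitFns P n ⊆ circuitFns P' n :=
  fun _ ⟨C, hC, hf⟩ => ⟨C, h C hC, hf⟩

/-- Larger leaf budgets give larger De Morgan formula classes. [folklore] -/
theorem deMorganFormulaFns_mono {s s' : ℕ → ℕ} {n : ℕ} (h : s n ≤ s' n) :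
    deMorganFormulaFns s n ⊆ deMorganFormulaFns s' n :=
  circuitFns_mono fun _ hC => ⟨hC.1, hC.2.1, hC.2.2.trans h⟩

/-- Larger leaf budgets give larger `B₂`-formula classes. [folklore] -/
theorem b2FormulaFns_mono {s s' : ℕ → ℕ} {n : ℕ} (h : s n ≤ s' n) :
    b2FormulaFns s n ⊆ b2FormulaFns s' n :=
  circuitFns_mono fun _ hC => ⟨hC.1, hC.2.1, hC.2.2.trans h⟩

/-- Larger node budgets give larger branching-program classes. [folklore] -/
theorem bpFns_mono {s s' : ℕ → ℕ} {n : ℕ} (h : s n ≤ s' n) : bpFns s n ⊆ bpFns s' n :=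
  fun _ ⟨P, hP, hf⟩ => ⟨P, hP.trans h, hf⟩

/-- De Morgan formulas are `B₂`-formulas of the same leaf size. [folklore] -/
theorem deMorganFormulaFns_subset_b2FormulaFns (s : ℕ → ℕ) (n : ℕ) :
    deMorganFormulaFns s n ⊆ b2FormulaFns s n :=
  circuitFns_mono fun _ hC => ⟨fun g hg => deMorganBasis_subset_B2 (hC.1 g hg), hC.2.1, hC.2.2⟩

/-- An obstruction against a larger leaf budget is one against a smaller (eventually).
[cite: ChenJinWilliams2020, Def. 1.12] -/
theorem HasExplicitObstruction.deMorgan_anti {s s' : ℕ → ℕ} (h : ∀ᶠ n in atTop, s n ≤ s' n)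
    (hO : HasExplicitObstruction (deMorganFormulaFns s')) : HasExplicitObstruction (deMorganFormulaFns s) :=
  hO.anti (h.mono fun _ hn => deMorganFormulaFns_mono hn)

/-- An obstruction against `B₂`-formulas is one against De Morgan formulas of the same size.
[cite: ChenJinWilliams2020, Def. 1.12] -/
theorem HasExplicitObstruction.deMorgan_of_b2 {s : ℕ → ℕ} (hO : HasExplicitObstruction (b2FormulaFns s)) :
    HasExplicitObstruction (deMorganFormulaFns s) :=
  hO.anti (Eventually.of_forall fun n => deMorganFormulaFns_subset_b2FormulaFns s n)

/-- Theorem 1.15, *"(2) ⟹ (1). Trivial."* — with `α = 1`: `⌈N^{2+1}⌉ = N³`. [cite: ChenJinWilliams2020, Thm. 1.15 (proof, (2) ⇒ (1))] -/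
theorem item115i_of_item115ii (h : Item115ii) : Item115i := by
  refine ⟨1, one_pos, (h 3).deMorgan_anti (Eventually.of_forall fun n => ?_)⟩
  have : ((n : ℝ) ^ (2 + 1 : ℝ)) = ((n ^ 3 : ℕ) : ℝ) := by
    rw [show (2 + 1 : ℝ) = (3 : ℕ) by norm_num, Real.rpow_natCast]; push_cast; ring
  simp [thresholdBound13, this]

/-- Theorem 1.18, 2 ⟹ 1 (trivial direction), with `α = 1`. [cite: ChenJinWilliams2020, Thm. 1.18] -/
theorem item118i_of_item118ii (h : Item118ii) : Item118i := by
  refine ⟨1, one_pos, (h 2).anti (Eventually.of_forall fun n => b2FormulaFns_mono ?_)⟩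
  have : ((n : ℝ) ^ (1 + 1 : ℝ)) = ((n ^ 2 : ℕ) : ℝ) := by
    rw [show (1 + 1 : ℝ) = (2 : ℕ) by norm_num, Real.rpow_natCast]; push_cast; ring
  simp [this]

/-- With Theorem 1.16: an explicit obstruction against `N²⌈log₂N⌉^{f N}`-leaf formulas for some
`f → ∞` separates `E` from `NC¹`. [cite: ChenJinWilliams2020, Thm. 1.16] -/
theorem not_E_subset_NC1_of_hypothesis116 (hT : thm1_16) {f : ℕ → ℕ} (hf : Tendsto f atTop atTop)
    (hO : Hypothesis116 f) : ¬ (E ⊆ NC1) :=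
  hT ⟨f, hf, hO⟩

/-! ### Proved: Proposition 1.17's obstruction `S = {(0ⁿ, 0)} ∪ {(0^{i−1}10^{n−i}, 1) | i ∈ [n]}` -/

/-- The printed list `S = {(0ⁿ, 0)} ∪ {(eᵢ, 1) | i ∈ [n]}` of Proposition 1.17.
[cite: ChenJinWilliams2020, Prop. 1.17 (proof)] -/
def unitObstruction (n : ℕ) : List (List Bool × Bool) :=
  (List.replicate n false, false) ::
    (List.finRange n).map fun i => (List.ofFn fun j : Fin n => decide (j = i), true)

/-- The inputs of `S` are pairwise distinct. [cite: ChenJinWilliams2020, Prop. 1.17 (proof)] -/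
theorem unitObstruction_nodup (n : ℕ) : ((unitObstruction n).map Prod.fst).Nodup := by
  unfold unitObstruction
  rw [List.map_cons, List.nodup_cons, List.map_map]
  constructor
  · simp only [List.mem_map, List.mem_finRange, true_and, Function.comp_apply, not_exists]
    intro i h
    have := congrArg (fun l : List Bool => l.getD i false) h
    simp [List.getD_eq_getElem?_getD] at this
  · refine (List.nodup_finRange n).map fun i i' h => ?_
    have := congrArg (fun l : List Bool => l.getD i false) h
    simpa [List.getD_eq_getElem?_getD] using this

/-- **`S` refutes every circuit that does not read some variable** (any basis, formula or not): if
`C(0ⁿ) = 1` the pair `(0ⁿ, 0)` refutes `C`; otherwise `C(eᵢ) = C(0ⁿ) = 0` for the unread `i` and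
`(eᵢ, 1)` does. [cite: ChenJinWilliams2020, Prop. 1.17 (proof)] -/
theorem refutes_unitObstruction_of_not_mem_lightCone {n : ℕ} (C : Circuit (Fin n)) {i : Fin n}
    (hi : i ∉ C.lightCone) : Refutes (unitObstruction n) n C.eval := by
  have hagree : C.eval (fun j : Fin n => decide (j = i)) = C.eval (fun _ => false) :=
    C.eval_congr_lightCone fun j hj => by
      have : j ≠ i := fun h => hi (h ▸ hj)
      simp [this]
  cases h0 : C.eval (fun _ => false)
  · refine ⟨(List.ofFn fun j : Fin n => decide (j = i), true), ?_, by simp, ?_⟩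
    · simp [unitObstruction]
    · have : (fun k : Fin n => (List.ofFn fun j : Fin n => decide (j = i)).getD k false) =
          fun j => decide (j = i) := by
        funext k; simp [List.getD_eq_getElem?_getD]
      rw [this, hagree, h0]; simp
  · refine ⟨(List.replicate n false, false), by simp [unitObstruction], by simp, ?_⟩
    have : (fun k : Fin n => (List.replicate n false).getD k false) = fun _ => false := by
      funext k; simp [List.getD_eq_getElem?_getD]
    rw [this, h0]; simp

/-- **`S` refutes every circuit with fewer than `n` leaves.** [cite: ChenJinWilliams2020, Prop. 1.17 (proof)] -/
theorem refutes_unitObstruction_of_leafSize_lt {n : ℕ} (C : Circuit (Fin n)) (h : C.leafSize < n) :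
    Refutes (unitObstruction n) n C.eval := by
  obtain ⟨i, hi⟩ := exists_not_mem_lightCone C h
  exact refutes_unitObstruction_of_not_mem_lightCone C hi

/-- **`S` refutes every branching program with fewer than `n` inner nodes.**
[cite: ChenJinWilliams2020, Prop. 1.17 (proof)] -/
theorem refutes_unitObstruction_bp_of_size_lt {n : ℕ} (P : BranchingProgram n) (h : P.size < n) :
    Refutes (unitObstruction n) n P.eval := by
  obtain ⟨i, hi⟩ := bp_exists_unqueried P h
  have hagree : P.eval (fun j : Fin n => decide (j = i)) = P.eval (fun _ => false) :=
    bp_eval_congr P fun v => by simp [hi v]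
  cases h0 : P.eval (fun _ => false)
  · refine ⟨(List.ofFn fun j : Fin n => decide (j = i), true), ?_, by simp, ?_⟩
    · simp [unitObstruction]
    · have : (fun k : Fin n => (List.ofFn fun j : Fin n => decide (j = i)).getD k false) =
          fun j => decide (j = i) := by
        funext k; simp [List.getD_eq_getElem?_getD]
      rw [this, hagree, h0]; simp
  · refine ⟨(List.replicate n false, false), by simp [unitObstruction], by simp, ?_⟩
    have : (fun k : Fin n => (List.replicate n false).getD k false) = fun _ => false := by
      funext k; simp [List.getD_eq_getElem?_getD]
    rw [this, h0]; simp

/-- `S` is an obstruction at length `n` against all circuits (any constraint) of leaf size `< n`.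
[cite: ChenJinWilliams2020, Prop. 1.17 (proof)] -/
theorem unitObstruction_refutesAll_circuitFns {P : ∀ n : ℕ, Circuit (Fin n) → Prop} {n : ℕ}
    (hP : ∀ C, P n C → C.leafSize < n) : RefutesAll (unitObstruction n) n (circuitFns P n) := by
  refine ⟨unitObstruction_nodup n, fun f ⟨C, hC, hf⟩ => ?_⟩
  have : f = C.eval := funext fun x => (hf x).symm
  rw [this]
  exact refutes_unitObstruction_of_leafSize_lt C (hP C hC)

/-- `S` is an obstruction at length `n` against `B₂`-formulas of leaf size `≤ s n` whenever `s n < n`.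
[cite: ChenJinWilliams2020, Prop. 1.17 (proof)] -/
theorem unitObstruction_refutesAll_b2 {s : ℕ → ℕ} {n : ℕ} (hs : s n < n) :
    RefutesAll (unitObstruction n) n (b2FormulaFns s n) :=
  unitObstruction_refutesAll_circuitFns fun _ hC => lt_of_le_of_lt hC.2.2 hs

/-- `S` is an obstruction at length `n` against branching programs of size `≤ s n` whenever
`s n < n`. [cite: ChenJinWilliams2020, Prop. 1.17 (proof)] -/
theorem unitObstruction_refutesAll_bp {s : ℕ → ℕ} {n : ℕ} (hs : s n < n) :
    RefutesAll (unitObstruction n) n (bpFns s n) := by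
  refine ⟨unitObstruction_nodup n, fun f ⟨P, hP, hf⟩ => ?_⟩
  have : f = P.eval := funext fun x => (hf x).symm
  rw [this]
  exact refutes_unitObstruction_bp_of_size_lt P (lt_of_le_of_lt hP hs)

/-- `s = o(n)` forces `s n < n` for all large `n`. [folklore] -/
theorem eventually_lt_of_isLittleO {s : ℕ → ℕ}
    (hs : (fun n => (s n : ℝ)) =o[atTop] (fun n => (n : ℝ))) : ∀ᶠ n in atTop, s n < n := by
  have h := hs.def one_half_pos
  filter_upwards [h, eventually_ge_atTop 1] with n hn hn1
  rw [Real.norm_natCast, Real.norm_natCast] at hn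
  have : (s n : ℝ) < n := hn.trans_lt (by
    have : (0 : ℝ) < n := by exact_mod_cast hn1
    linarith)
  exact_mod_cast this

/-- The residual hypothesis of Proposition 1.17: the printed list `n ↦ S` is polynomial-time
computable from `1ⁿ` in the tree's machine model (a routine TM2 program, not written here).
[cite: ChenJinWilliams2020, Prop. 1.17 (proof: "can simply be the set S")] -/
def UnitObstructionPolyTime : Prop := PolyTimeComputable unaryEncodeNat obstructionEncode unitObstruction

/-- **Proposition 1.17 from its residual hypothesis**: if `n ↦ S` runs in polynomial time then `S`
is an explicit obstruction against `B₂`-formulas of size `s` and against branching programs of size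
`s`, for every `s` with `s n < n` eventually — in particular for every `s = o(n)` (`prop1_17_of_polyTime`).
[cite: ChenJinWilliams2020, Prop. 1.17] -/
theorem isExplicitObstruction_unitObstruction (hA : UnitObstructionPolyTime) {s : ℕ → ℕ}
    (hs : ∀ᶠ n in atTop, s n < n) :
    IsExplicitObstruction (b2FormulaFns s) unitObstruction ∧ IsExplicitObstruction (bpFns s) unitObstruction :=
  ⟨⟨hA, hs.mono fun _ hn => unitObstruction_refutesAll_b2 hn⟩,
    ⟨hA, hs.mono fun _ hn => unitObstruction_refutesAll_bp hn⟩⟩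

/-- **Proposition 1.17, proved modulo the running time of `S`.** [cite: ChenJinWilliams2020, Prop. 1.17] -/
theorem prop1_17_of_polyTime (hA : UnitObstructionPolyTime) : prop1_17 := fun _ hs =>
  let h := isExplicitObstruction_unitObstruction hA (eventually_lt_of_isLittleO hs)
  ⟨⟨_, h.1⟩, ⟨_, h.2⟩⟩

end Literature.Computability.MetaComplexity.ChenJinWilliams2020
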